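import Mathlib.RingTheory.FiniteType
import Mathlib.Algebra.Group.End
import Mathlib.Logic.Equiv.Fintype
import HarnessLib

/-!
# Equivariant polynomial presentations of a finitely generated algebra with a finite group action

Topic `Literature/AlgebraicGeometry/GroupActions`. One theorem, no definition, no named fact.

**Statement** (`exists_equivariant_presentation`). Let `ψ : K → R` be a ring map of finite type and let a
finite group `G` act on `R` by ring endomorphisms over `K`, written contravariantly — `β (g h) = β h ∘ β g`,
`β 1 = id` — as it arises from an action of `G` on `Spec R` by `K`-automorphisms (`g ↦ Γ(ρ g)`). Then there are
`n`, a SURJECTION `θ : K[y₁, …, yₙ] ↠ R` over `K`, and a homomorphism `π : G → 𝔖ₙ` with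
`β g ∘ θ = θ ∘ rename (π g)⁻¹` for every `g`: the generators `θ(yⱼ)` form a `G`-stable family which `G`
permutes. Proof: take a finite generating family `t₁, …, tₘ` (Mathlib
`Algebra.FiniteType.iff_quotient_mvPolynomial''`) and all its translates `β h⁻¹ (tᵢ)`, indexed by
`G × {1, …, m}`, on which `g` acts by left multiplication on the `G`-factor; transfer to `Fin n` along
`Fintype.equivFin`.

This is the algebraic half of the classical remark that an affine scheme of finite type with an action of a
FINITE group embeds equivariantly into an affine space on which the group acts by permuting the coordinates
(e.g. Mumford, *Abelian Varieties*, §7, proof of the Theorem on quotients by finite groups, where the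
translates of generators are used in the same way); the geometric half is
`Resolution/EquivariantProjectiveEmbedding`. Written for route `HodgeConjecture/Q8SymplecticPowers` (crux K1Q,
stmt-HodgeConjecture-24190, brick «B3» of the Kollár-free deck family) but route-agnostic; nothing here bears on HC.

## References

* [MumfordAV1970] D. Mumford, Abelian Varieties (1970), §7 (proof of the Theorem, p. 66).
-/

namespace Literature.AlgebraicGeometry.GroupActions

universe u v

open MvPolynomial

/-- **Equivariant presentation.** Let `ψ : K → R` make `R` a finitely generated `K`-algebra and let a finite group `G`
act on `R` by `K`-algebra endomorphisms, contravariantly (`β (g h) = β h ∘ β g`, `β 1 = id` — the shape of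
`g ↦ Γ(ρ g)` for an action `ρ` on `Spec R` by automorphisms). Then `R` has a presentation
`θ : K[y₁, …, yₙ] ↠ R` by a `G`-STABLE family of generators which `G` PERMUTES: there is a homomorphism
`π : G → 𝔖ₙ` with `β g ∘ θ = θ ∘ rename (π g)⁻¹` (take all translates `β h⁻¹ (tᵢ)` of a finite generating family
`tᵢ`, indexed by `G × {1, …, m}`, on which `g` acts through left multiplication on `G`).
[cite: MumfordAV1970, §7 (proof of the Theorem, p. 66)] -/
theorem exists_equivariant_presentation {K R : Type u} [CommRing K] [CommRing R] (ψ : K →+* R)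
    (hψ : ψ.FiniteType) {G : Type v} [Group G] [Finite G] (β : G → (R →+* R))
    (hβK : ∀ g, (β g).comp ψ = ψ) (hβmul : ∀ g h, β (g * h) = (β h).comp (β g)) (hβone : β 1 = RingHom.id R) :
    ∃ (n : ℕ) (θ : MvPolynomial (Fin n) K →+* R) (π : G →* Equiv.Perm (Fin n)),
      Function.Surjective θ ∧ θ.comp C = ψ ∧
      ∀ g, (β g).comp θ = θ.comp (rename ⇑(π g)⁻¹ : MvPolynomial (Fin n) K →ₐ[K] MvPolynomial (Fin n) K).toRingHom := by
  classical
  letI : Algebra K R := ψ.toAlgebra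
  haveI : Algebra.FiniteType K R := hψ
  haveI : Fintype G := Fintype.ofFinite G
  obtain ⟨m, θ₀, hθ₀⟩ := Algebra.FiniteType.iff_quotient_mvPolynomial''.mp (inferInstance : Algebra.FiniteType K R)
  -- the `K`-algebra endomorphisms
  let βₐ : G → (R →ₐ[K] R) := fun g =>
    { β g with commutes' := fun c => congrFun (congrArg DFunLike.coe (hβK g)) c }
  have hβₐ : ∀ g (r : R), βₐ g r = β g r := fun _ _ => rfl
  -- the `G`-stable generating family, indexed by `G × Fin m`, and its transfer to `Fin n`
  let ι := G × Fin m
  let e : ι ≃ Fin (Fintype.card ι) := Fintype.equivFin ι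
  let s : ι → R := fun hi => β hi.1⁻¹ (θ₀ (X hi.2))
  let θ₁ : MvPolynomial ι K →ₐ[K] R := aeval s
  let θ : MvPolynomial (Fin (Fintype.card ι)) K →ₐ[K] R := θ₁.comp (rename e.symm)
  -- `g` acts on the indices by left multiplication on the `G`-factor
  let π₀ : G →* Equiv.Perm ι :=
    { toFun := fun g => Equiv.prodCongr (Equiv.mulLeft g) (Equiv.refl _)
      map_one' := by ext ⟨h, i⟩ <;> simp
      map_mul' := fun g g' => by ext ⟨h, i⟩ <;> simp [mul_assoc] }
  let π : G →* Equiv.Perm (Fin (Fintype.card ι)) := (e.permCongrHom : _ ≃* _).toMonoidHom.comp π₀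
  have hπ : ∀ g (j : Fin (Fintype.card ι)), (π g)⁻¹ j = e ((g⁻¹ * (e.symm j).1), (e.symm j).2) := by
    intro g j
    rfl
  have hθX : ∀ j : Fin (Fintype.card ι), θ (X j) = β (e.symm j).1⁻¹ (θ₀ (X (e.symm j).2)) := by
    intro j
    change θ₁ (rename e.symm (X j)) = _
    rw [rename_X, aeval_X]
  refine ⟨Fintype.card ι, θ.toRingHom, π, ?_, ?_, fun g => ?_⟩
  · -- surjectivity: `θ₀ = θ ∘ rename (e ∘ (1, ·))`
    intro r
    obtain ⟨p, rfl⟩ := hθ₀ r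
    refine ⟨rename (fun i => e ((1 : G), i)) p, ?_⟩
    change θ (rename (fun i => e ((1 : G), i)) p) = θ₀ p
    have h1 : (θ.comp (rename (fun i => e ((1 : G), i)))) = θ₀ := by
      refine MvPolynomial.algHom_ext fun i => ?_
      change θ (rename _ (X i)) = θ₀ (X i)
      rw [rename_X, hθX, Equiv.symm_apply_apply]
      change β (1 : G)⁻¹ _ = _
      rw [inv_one, hβone, RingHom.id_apply]
    exact congrFun (congrArg DFunLike.coe h1) p
  · -- over `K`
    ext c
    change θ (C c) = ψ c
    rw [← MvPolynomial.algebraMap_eq, AlgHom.commutes]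
    rfl
  · -- equivariance, checked on the variables
    have key : (βₐ g).comp θ = θ.comp (rename ⇑(π g)⁻¹) := by
      refine MvPolynomial.algHom_ext fun j => ?_
      change βₐ g (θ (X j)) = θ (rename _ (X j))
      rw [rename_X, hθX, hθX, hπ, Equiv.symm_apply_apply, hβₐ, ← RingHom.comp_apply, ← hβmul, mul_inv_rev,
        inv_inv]
    ext p
    · change β g (θ (C p)) = θ (rename _ (C p))
      exact congrFun (congrArg DFunLike.coe key) (C p)
    · change β g (θ (X p)) = θ (rename _ (X p))
      exact congrFun (congrArg DFunLike.coe key) (X p)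

end Literature.AlgebraicGeometry.GroupActions
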